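import Summits.CriticalPhenomena.CardyFormulaZ2.Theses.CardyComplexCone
import Summits.CriticalPhenomena.CardyFormulaZ2.Theorems.CoherentMorera.Negative.KirchhoffModes
import Summits.CriticalPhenomena.CardyFormulaZ2.Theorems.CoherentMorera.Negative.CharacterSelectionLoadBearing
import Summits.CriticalPhenomena.CardyFormulaZ2.Theorems.CoherentMorera.Negative.VertexTraceStaggering
import Literature.Probability.LatticeModels.DartPhase

/-!
# Line `staggered-green-transfer` for the crux `CardyComplexCone.CoherentMorera`
(item stmt-CriticalPhenomena-11388, route `CardyComplexCone`, rank 4) — CHECKED SKELETON (crux-plan, round 1)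

The crux: `EdgeCoherence → EdgePrecompact → (WeakHolomorphyFamilies ∧ PrecompactFamilies)` for the
spin-`1/3` vertex observable `F_δ(z) = ∫ passageSum (medialExploration (Λ δ) ω) δ (1/3) z ∂P_{1/2}` of
critical bond percolation on `δℤ²` (rev 3, family form, lattice-edge guards).

Idea (card `Cruxes/CoherentMorera/Ideas/staggered-green-transfer.md`, triage r1: 3 × pass; merged with
its ℤ₄ companion `z4-trace-character-collapse` as every triager asked — "L1 + L2 + trace identity +
precompact transfer, told once"):

* **L1 — the staggered Green identity (THIS card's lever, `Sig.stub_staggeredGreenIdentity`,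
  deterministic).** Pair the exact `χ = +i` vertex relation (`Negative.KirchhoffAt`, DC12 Prop. 4 in the
  tree's conventions, four independent exact enumerations) against the test function: the discrete
  Green identity `Σ_e φ(z_e)·Kir_G(e) = 2 Σ_c i^{k(c)} G(c) [φ(z_s(c)) − φ(z_t(c))]` plus a third-order
  Taylor expansion about the corner midpoint `m_c` (second order cancels: `z_s − m_c = −(z_t − m_c)`;
  `i^k·(z_t − z_s) = (δ/2)(i−1)(−1)^k`, `i^k·conj(z_t − z_s) = −(δ/2)(1+i)`, `(i−1)/(1+i) = i`) give, for
  ANY corner field `G` with `‖G‖ ≤ M` obeying Kirchhoff at the lattice edges whose midpoint lies in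
  `tsupport φ`:  `‖Σ_c G(c)·∂̄φ(m_c) − i·Σ_c (−1)^{k(c)} G(c)·∂φ(m_c)‖ ≤ C(φ)·M`
  (each sum alone is `O(M/δ²)`; the content is the cancellation).  So weak holomorphy of the
  `A₀`-type corner pairing ⟺ weak `∂`-nullity of the STAGGERED (`ℤ₄`-mode 2, spin `7/3`) pairing.
* **Trace identity (`Sig.stub_vertexResummation`).** `2cos(π/12)·F_δ(z) = Σ_{c ∼ z} E_δ(c)` pathwise
  off the two `A`–`B` edges (cdisprove g2; = `Sig.stub_fourCornerSplit` of the sibling line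
  `Cruxes/ParafermionPrecompact/Lines/four-class-vertex-transfer.lean`), so the crux's clause-(i) quantity
  `V_δ(φ) = δ^{5/3} Σ_z F_δ(z) ∂̄φ(z_δ)` equals `(cos π/12)⁻¹ δ^{5/3} Σ_c E_δ(c) ∂̄φ(m_c) + O(δ^{5/3})`
  (`|E_δ| ≤ 1`, `norm_bondDartObservable_le_one`).
* **L2 — character or null (`Sig.stub_quarterTurnCoherence` + `Sig.stub_characterOrNull`).** The EXACT
  quarter-turn covariance `E^{iD,iΛ}_δ(Rv, Rf − e₀) = E^{D,Λ}_δ(v,f)` (certified on 40 corners, deviation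
  0.0) makes the set of universal coherence vectors `classShift`-invariant; comparing the coherence
  systems of `u` and `u ∘ classShift` at one site (2×2 elimination) gives: either `u ∘ classShift = λ·u`
  on the four classes (`λ⁴ = 1`, a `ℤ₄`-character — `Negative.IsZ4Character`) or every corner value is
  `O(ε)δ^{1/3}` on compacts for every family (null ⇒ every pairing `o(1)`).  For a character the
  `λ`-table (`Σ_k λ^k = 0` unless `λ = 1`; `Σ_k (−λ)^k = (1−λ)(1+λ²) = 0` unless `λ = −1`) and coherence
  give `A₀ = Σ_k E(v,k) = O(εδ^{1/3})` (λ ≠ 1) or `A₂ = Σ_k (−1)^k E(v,k) = O(εδ^{1/3})` (λ = 1) UNIFORMLY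
  on compacts; counting the `O(δ⁻²)` corners under `supp ψ` turns either into a null pairing at weight
  `δ^{5/3}`.  Hence: `A₀`-pairings null (⇒ clause (i) by the trace identity) OR `A₂`-pairings null
  (⇒ `A₀`-pairing against `∂̄φ` null by L1 + Kirchhoff ⇒ clause (i)).
* **Clause (ii) (`Sig.stub_precompactTransfer`)** needs `EdgePrecompact` only (INCLUDING its
  equicontinuity clause (ii) — `Negative.traceH_stag_jump` shows it is load-bearing): the sibling line's
  corner→vertex transfer with the `ρ`-thickening of `K`, the two `A`–`B` edges leaving every compact
  WITHOUT the marks hypothesis (their sites lie in `zdBoundary`, within `(√2 + ½)δ` of `∂D`).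
* **Kirchhoff itself (`Sig.stub_cornerKirchhoff`)** is the one owed model lemma shared by every line of
  this crux: DC12 Prop. 4 / DCS12 Prop. 8.6 with `χ = +i` for `medialExploration`/`bcBondConfig`, at
  lattice edges whose midpoint lies in a compact `K ⊂ D`, eventually in `δ`, for JORDAN carriers
  (`(Λ δ).Ω = D.carrier` ⇒ the face domain is simply connected at every mesh — triage r1-1 §geometric
  point, r1-3 — so the refuted-misstated annulus witness of `CardySublatticeCoherence.HalfCRVertexRelation`
  (stmt-11306: marks on a HOLE) is outside this statement's scope).

The composition `CoherentMorera_of : Sig.stub_cornerKirchhoff → Sig.stub_staggeredGreenIdentity →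
Sig.stub_vertexResummation → Sig.stub_quarterTurnCoherence → Sig.stub_characterOrNull →
Sig.stub_precompactTransfer → CoherentMorera` is a real proof (filters, `Tendsto` algebra, regularity of
`∂̄φ`/`∂φ` as test functions, `|E_δ| ≤ 1`); `sorry` occurs only in the six registered `stub_*`.

Disproof honoured (crux workfile `Disproof.lean`, g3; landed `Theorems/CoherentMorera/Negative/*`,
all three imported here): §A one-sidedness (nothing to do); §B–§D = the frame these stubs are typed in
(`KirchhoffAt`, modes, `IsZ4Character`, `character_single_mode`); §E `CharacterSelectionLoadBearing`
(rotation covariance is LOAD-BEARING: `kirchhoffAt_modelField`, `coherence_defect`, `uModel_not_character`,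
`dbar_A0_modelField_eq_zero_iff`) — the line uses the quarter turn at `stub_quarterTurnCoherence` and
consumes it in `stub_characterOrNull`, and the abstract model `modelField μ` (coherent with the
NON-`classShift`-invariant vector `uModel μ`, `μ ∉ {±1}`) is not a counterexample to any stub: it is not a
percolation observable (S1, S3–S5 quantify over `cornerField Λ δ` only) and S2 holds for it (it is
Kirchhoff; S2 asserts only `P₀ = iP₂ + O(M)`, true with `P₂ ≠ 0`, `A2_modelField`); §F
`VertexTraceStaggering` (EdgePrecompact (ii) load-bearing for clause 2): `stub_precompactTransfer` takes
the whole of `EdgePrecompact`. No `_false_without_` theorem, tightness lemma or `-- Targets` stub kill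
exists for this crux (none is re-asked). Negatives index (SAW tightness 0772/8261/8312, 7073, 6949, the
rev-2 junk-twin refutations 11266/11268): every statement below is in family form along `𝓝[>] 0`,
corner statements carry `IsCorner`/`faceAt`, vertex statements are the edge-guarded crux clauses verbatim.

Name-resolution note. `KirchhoffModes` imports `MedialInterfaceProofs`, hence `FermionicObservable`, whose
real constants `…LatticeModels.winding/passageSum` shadow the `PolylineWinding`/`MedialWinding` ALIASES the
route decls elaborate to; every copy of route text below therefore spells `Polyline.winding` and
`MedialPath.passageSum` (certificates `edgeCoherence_iff`, `edgePrecompact_iff`, `coherentMorera_iff` are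
`Iff.rfl`).
-/

noncomputable section

namespace Summit.CriticalPhenomena.CardyFormulaZ2.Cruxes.CoherentMorera.StaggeredGreenTransfer

open scoped BigOperators Topology
open Filter Set MeasureTheory
open Literature.Probability.LatticeModels Literature.Probability.RandomPlanarGeometry
open Literature.Probability.Percolation (BondConfig bondPercolation half)
open Summit.CriticalPhenomena.CardyFormulaZ2.Theses.CardyComplexCone
  (EdgeCoherence EdgePrecompact CoherentMorera)
open Summit.CriticalPhenomena.CardyFormulaZ2.Theorems.CoherentMorera.Negative
  (KirchhoffAt wt IsZ4Character)

/-! ### Vocabulary: the route's observables, verbatim, in the `(site, class)` coding -/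

/-- The integrand of the route's corner observable at mesh `δ`, datum `E`, corner `(v, f)`: VERBATIM the
integrand of the `let E` of `EdgeCoherence` / `EdgePrecompact` with `Λ δ ↦ E` (alias-safe spelling
`Polyline.winding`). It is `Parafermion.dartPhaseSum (medialExploration E ω) δ (1/3) (v, f)`
(`cornerPhase_eq_dartPhaseSum`). -/
def cornerPhase (E : DiscreteDobrushin) (δ : ℝ) (v f : Site 2) (ω : BondConfig (Site 2)) : ℂ :=
  (let γ := Literature.Probability.LatticeModels.medialExploration E ω; ∑ k ∈ (Finset.range γ.length).filter (fun k => γ[k]? = some (Literature.Probability.LatticeModels.cornerSource v f) ∧ γ[k + 1]? = some (Literature.Probability.LatticeModels.cornerTarget v f)), Complex.exp (-(Complex.I / 3) * ((Literature.Probability.LatticeModels.Polyline.winding ((γ.map (Literature.Probability.LatticeModels.medialPoint δ)).take (k + 2)) : ℝ) : ℂ)))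

/-- The route's spin-`1/3` CORNER observable `E_δ(v, f)` of the family `Λ` (face-indexed, as in the route). -/
def cornerObs (Λ : ℝ → DiscreteDobrushin) (δ : ℝ) (v f : Site 2) : ℂ :=
  ∫ ω, cornerPhase (Λ δ) δ v f ω ∂(bondPercolation (zdGraph 2) half)

/-- The same observable in the `(site, class)` coding of `MedialInterfaceProofs` / `Negative.KirchhoffModes`:
the class-`k` corner at `v` is `(v, faceAt v k)` (offset `f − v = −cornerOff k ∈ {0, −e₀, −e₀−e₁, −e₁}`,
travel direction `e^{3πi/4} i^k` = NW, SW, SE, NE). -/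
def cornerField (Λ : ℝ → DiscreteDobrushin) (δ : ℝ) : Site 2 → Fin 4 → ℂ :=
  fun v k => cornerObs Λ δ v (faceAt v k)

/-- The midpoint of the corner `(v, k)` at mesh `δ`: the corner is the medial edge from the midpoint of
the lattice edge `s(v, v + cornerUnit k)` (`cornerSource_faceAt`) to that of `s(v, v + cornerUnit (k+1))`
(`cornerTarget_faceAt`); its midpoint is `δ·v + δ·i^k (1+i)/4`. -/
def cornerMid (δ : ℝ) (v : Site 2) (k : Fin 4) : ℂ :=
  (medialPoint δ s(v, v + cornerUnit k) + medialPoint δ s(v, v + cornerUnit (k + 1))) / 2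

/-- The staggering sign `ε(k) = (−1)^k`: `+1` on the travel classes NW/SE (`k = 0, 2`), `−1` on SW/NE
(`k = 1, 3`) — the character `χ₂ = (1,−1,1,−1)` of the card (`= wt k ^ 2`). -/
def stag : Fin 4 → ℂ
  | 0 => 1
  | 1 => -1
  | 2 => 1
  | 3 => -1

/-- `∂̄ψ = (ψ_x + i ψ_y)/2` of a real-differentiable `ψ : ℂ → ℂ` (the expression of the crux's clause (i)). -/
def dbar (ψ : ℂ → ℂ) (p : ℂ) : ℂ := (fderiv ℝ ψ p 1 + Complex.I * fderiv ℝ ψ p Complex.I) / 2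

/-- `∂ψ = (ψ_x − i ψ_y)/2`. -/
def del (ψ : ℂ → ℂ) (p : ℂ) : ℂ := (fderiv ℝ ψ p 1 - Complex.I * fderiv ℝ ψ p Complex.I) / 2

/-- The `A₀`-type (plain) corner pairing of a corner field `G` against a weight `ψ` read at corner
midpoints: `Σ_{(v,k)} G(v,k)·ψ(m_{v,k})` (a `finsum`; finite whenever `ψ` has compact support and `δ ≠ 0`). -/
def pair0 (G : Site 2 → Fin 4 → ℂ) (ψ : ℂ → ℂ) (δ : ℝ) : ℂ :=
  ∑ᶠ p : Site 2 × Fin 4, G p.1 p.2 * ψ (cornerMid δ p.1 p.2)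

/-- The `A₂`-type (STAGGERED) corner pairing: `Σ_{(v,k)} (−1)^k G(v,k)·ψ(m_{v,k})`. -/
def pair2 (G : Site 2 → Fin 4 → ℂ) (ψ : ℂ → ℂ) (δ : ℝ) : ℂ :=
  ∑ᶠ p : Site 2 × Fin 4, stag p.2 * G p.1 p.2 * ψ (cornerMid δ p.1 p.2)

/-- The three family guards of the crux (domain, mesh, eventual `ℤ²`-admissibility). -/
def Guards (D : DobrushinDomain) (Λ : ℝ → DiscreteDobrushin) : Prop :=
  (∀ δ, (Λ δ).Ω = D.carrier) ∧ (∀ δ, (Λ δ).δ = δ) ∧ (∀ᶠ δ in 𝓝[>] (0:ℝ), (Λ δ).IsZdAdmissible)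

/-- The crux's test functions on `D`: smooth, compactly supported inside the (open) carrier. -/
def TestFn (D : DobrushinDomain) (ψ : ℂ → ℂ) : Prop :=
  ContDiff ℝ (⊤ : ℕ∞) ψ ∧ HasCompactSupport ψ ∧ tsupport ψ ⊆ D.carrier

/-- The clause-(i) quantity of the crux for one family and one test function at mesh `δ`:
`V_δ(φ) = δ^{5/3} Σ_z F_δ(z)·∂̄φ(z_δ)` — VERBATIM the function inside the `Tendsto` of the crux's first
conclusion (alias-safe spelling `MedialPath.passageSum`). -/
def vertexPairing (Λ : ℝ → DiscreteDobrushin) (φ : ℂ → ℂ) (δ : ℝ) : ℂ :=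
  ((δ ^ ((5:ℝ) / 3) : ℝ) : ℂ) * ∑ᶠ z : Literature.Probability.LatticeModels.MedialVertex, (∫ ω, Literature.Probability.LatticeModels.MedialPath.passageSum (Literature.Probability.LatticeModels.medialExploration (Λ δ) ω) δ (1 / 3) z ∂(Literature.Probability.Percolation.bondPercolation (Literature.Probability.LatticeModels.zdGraph 2) Literature.Probability.Percolation.half)) * ((fderiv ℝ φ (Literature.Probability.LatticeModels.medialPoint δ z) 1 + Complex.I * fderiv ℝ φ (Literature.Probability.LatticeModels.medialPoint δ z) Complex.I) / 2)

/-- Conclusion (i) of the crux — family-form weak holomorphy of the vertex observable — copied verbatim. -/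
def WeakHolomorphyFamilies : Prop :=
  ∀ (D : Literature.Probability.RandomPlanarGeometry.DobrushinDomain) (Λ : ℝ → Literature.Probability.LatticeModels.DiscreteDobrushin), (∀ δ, (Λ δ).Ω = D.carrier) → (∀ δ, (Λ δ).δ = δ) → (∀ᶠ δ in 𝓝[>] (0:ℝ), (Λ δ).IsZdAdmissible) → ∀ (φ : ℂ → ℂ), ContDiff ℝ (⊤ : ℕ∞) φ → HasCompactSupport φ → tsupport φ ⊆ D.carrier → Tendsto (fun δ : ℝ => ((δ ^ ((5:ℝ) / 3) : ℝ) : ℂ) * ∑ᶠ z : Literature.Probability.LatticeModels.MedialVertex, (∫ ω, Literature.Probability.LatticeModels.MedialPath.passageSum (Literature.Probability.LatticeModels.medialExploration (Λ δ) ω) δ (1 / 3) z ∂(Literature.Probability.Percolation.bondPercolation (Literature.Probability.LatticeModels.zdGraph 2) Literature.Probability.Percolation.half)) * ((fderiv ℝ φ (Literature.Probability.LatticeModels.medialPoint δ z) 1 + Complex.I * fderiv ℝ φ (Literature.Probability.LatticeModels.medialPoint δ z) Complex.I) / 2)) (𝓝[>] (0:ℝ)) (𝓝 0)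

/-- Conclusion (ii) of the crux — local bound and equicontinuity of `δ^{-1/3}F_δ` on LATTICE EDGES (rev-3
guards) — copied verbatim. -/
def PrecompactFamilies : Prop :=
  ∀ (D : Literature.Probability.RandomPlanarGeometry.DobrushinDomain) (Λ : ℝ → Literature.Probability.LatticeModels.DiscreteDobrushin), (∀ δ, (Λ δ).Ω = D.carrier) → (∀ δ, (Λ δ).δ = δ) → (∀ᶠ δ in 𝓝[>] (0:ℝ), (Λ δ).IsZdAdmissible) → let F : ℝ → Literature.Probability.LatticeModels.MedialVertex → ℂ := fun δ z => ∫ ω, Literature.Probability.LatticeModels.MedialPath.passageSum (Literature.Probability.LatticeModels.medialExploration (Λ δ) ω) δ (1 / 3) z ∂(Literature.Probability.Percolation.bondPercolation (Literature.Probability.LatticeModels.zdGraph 2) Literature.Probability.Percolation.half); ∀ K : Set ℂ, IsCompact K → K ⊆ D.carrier → (∃ C : ℝ, ∀ᶠ δ in 𝓝[>] (0:ℝ), ∀ z : Literature.Probability.LatticeModels.MedialVertex, z ∈ (Literature.Probability.LatticeModels.zdGraph 2).edgeSet → Literature.Probability.LatticeModels.medialPoint δ z ∈ K → ‖F δ z‖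 ≤ C * δ ^ ((1:ℝ) / 3)) ∧ (∀ ε > (0:ℝ), ∃ η > (0:ℝ), ∀ᶠ δ in 𝓝[>] (0:ℝ), ∀ z z' : Literature.Probability.LatticeModels.MedialVertex, z ∈ (Literature.Probability.LatticeModels.zdGraph 2).edgeSet → z' ∈ (Literature.Probability.LatticeModels.zdGraph 2).edgeSet → Literature.Probability.LatticeModels.medialPoint δ z ∈ K → Literature.Probability.LatticeModels.medialPoint δ z' ∈ K → dist (Literature.Probability.LatticeModels.medialPoint δ z) (Literature.Probability.LatticeModels.medialPoint δ z') < η → ‖F δ z - F δ z'‖ ≤ ε * δ ^ ((1:ℝ) / 3))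

/-- The matrix of `EdgeCoherence` with the class vector `u` free — copied verbatim (alias-safe
`Polyline.winding`). -/
def EdgeCoherenceWith (u : Site 2 → ℂ) : Prop :=
  ∀ (D : Literature.Probability.RandomPlanarGeometry.DobrushinDomain) (Λ : ℝ → Literature.Probability.LatticeModels.DiscreteDobrushin), (∀ δ, (Λ δ).Ω = D.carrier) → (∀ δ, (Λ δ).δ = δ) → (∀ᶠ δ in nhdsWithin (0:ℝ) (Set.Ioi 0), (Λ δ).IsZdAdmissible) → let E : ℝ → Literature.Probability.LatticeModels.Site 2 → Literature.Probability.LatticeModels.Site 2 → ℂ := fun δ v f => ∫ ω, (let γ := Literature.Probability.LatticeModels.medialExploration (Λ δ) ω; ∑ k ∈ (Finset.range γ.length).filter (fun k => γ[k]? = some (Literature.Probability.LatticeModels.cornerSource v f) ∧ γ[k + 1]? = some (Literature.Probability.LatticeModels.cornerTarget v f)), Complex.exp (-(Complex.I / 3) * ((Literature.Probability.LatticeModels.Polyline.winding ((γ.map (Literature.Probability.LatticeModels.medialPoint δ)).take (k + 2)) : ℝ) : ℂ))) ∂(Literature.Probability.Percolation.bondPercolation (Literature.Probability.LatticeModels.zdGraph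 2) Literature.Probability.Percolation.half); ∀ K : Set ℂ, IsCompact K → K ⊆ D.carrier → ∀ ε > (0:ℝ), ∀ᶠ δ in nhdsWithin (0:ℝ) (Set.Ioi 0), ∀ v f f' : Literature.Probability.LatticeModels.Site 2, Literature.Probability.LatticeModels.IsCorner v f → Literature.Probability.LatticeModels.IsCorner v f' → Literature.Probability.LatticeModels.meshPoint δ v ∈ K → ‖u (f' - v) * E δ v f - u (f - v) * E δ v f'‖ ≤ ε * δ ^ ((1:ℝ) / 3)

/-- The `ℤ₄` shift of corner classes induced by the counter-clockwise quarter turn `R(a, b) = (−b, a)` of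
`ℤ²` with the face re-indexed by its new lower-left corner, `(v, f) ↦ (Rv, Rf − e₀)`: on offsets
`o = f − v` it is `o ↦ R o − e₀`, cycling `0 ↦ −e₀ ↦ −e₀−e₁ ↦ −e₁ ↦ 0` (class `k ↦ k + 1`); an affine
bijection of `ℤ²` of order `4`. -/
def classShift (o : Site 2) : Site 2 := ![-(o 1), o 0] - Pi.single 0 1

/-! ### Certificates that the copies ARE the route's texts -/

/-- `EdgeCoherence` is `∃ u ≠ 0 (on some class), EdgeCoherenceWith u` — by `Iff.rfl`. -/
theorem edgeCoherence_iff :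
    EdgeCoherence ↔ ∃ u : Site 2 → ℂ, (∃ o : Site 2, IsCorner 0 o ∧ u o ≠ 0) ∧ EdgeCoherenceWith u :=
  Iff.rfl

/-- The crux is literally `EdgeCoherence → EdgePrecompact → (WeakHolomorphyFamilies ∧ PrecompactFamilies)`. -/
theorem coherentMorera_iff :
    CoherentMorera ↔ (EdgeCoherence → EdgePrecompact → (WeakHolomorphyFamilies ∧ PrecompactFamilies)) :=
  Iff.rfl

/-- `EdgePrecompact` read over `cornerObs` (definitional). -/
theorem edgePrecompact_iff :
    EdgePrecompact ↔ ∀ (D : DobrushinDomain) (Λ : ℝ → DiscreteDobrushin), (∀ δ, (Λ δ).Ω = D.carrier) →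
      (∀ δ, (Λ δ).δ = δ) → (∀ᶠ δ in 𝓝[>] (0:ℝ), (Λ δ).IsZdAdmissible) → ∀ K : Set ℂ, IsCompact K →
        K ⊆ D.carrier →
          (∃ C : ℝ, ∀ᶠ δ in 𝓝[>] (0:ℝ), ∀ v f : Site 2, IsCorner v f → meshPoint δ v ∈ K →
              ‖cornerObs Λ δ v f‖ ≤ C * δ ^ ((1:ℝ) / 3)) ∧
          (∀ ε > (0:ℝ), ∃ η > (0:ℝ), ∀ᶠ δ in 𝓝[>] (0:ℝ), ∀ v f v' f' : Site 2,
              IsCorner v f → IsCorner v' f' → f - v = f' - v' → meshPoint δ v ∈ K →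
                meshPoint δ v' ∈ K → dist (meshPoint δ v) (meshPoint δ v') < η →
                  ‖cornerObs Λ δ v f - cornerObs Λ δ v' f'‖ ≤ ε * δ ^ ((1:ℝ) / 3)) :=
  Iff.rfl

/-- The vertex pairing is the function inside the crux's clause (i) (definitional). -/
theorem weakHolomorphyFamilies_iff :
    WeakHolomorphyFamilies ↔ ∀ (D : DobrushinDomain) (Λ : ℝ → DiscreteDobrushin), (∀ δ, (Λ δ).Ω = D.carrier) →
      (∀ δ, (Λ δ).δ = δ) → (∀ᶠ δ in 𝓝[>] (0:ℝ), (Λ δ).IsZdAdmissible) → ∀ φ : ℂ → ℂ,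
        ContDiff ℝ (⊤ : ℕ∞) φ → HasCompactSupport φ → tsupport φ ⊆ D.carrier →
          Tendsto (fun δ : ℝ => vertexPairing Λ φ δ) (𝓝[>] (0:ℝ)) (𝓝 0) :=
  Iff.rfl

/-! ### The six registered stubs

Each stub's statement is the `Prop` `Sig.stub_<name>`; the registered obligation is
`theorem stub_<name> : Sig.stub_<name> := by sorry`; `CoherentMorera_of` takes the six statements as
hypotheses BY NAME. Sizes: S1 L (owed model lemma, shared by every line of this crux), S2 M (deterministic,
provable now), S3 M–L (given the cdisprove-g2 four-corner split), S4 L (exact symmetry bookkeeping + the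
rotated Dobrushin domain), S5 M (finitary algebra + counting), S6 M (= the sibling skeleton's transfer). -/

/-- STUB 1 — **KIRCHHOFF for the percolation corner observable** (DC12 Prop. 4 / DCS12 Prop. 8.6 with
chirality `χ = +i`, in the flux form `Negative.KirchhoffAt`: at the lattice edge `e = s(v, v + cornerUnit k)`
the direction-weighted sum over the two corners leaving `e` equals that over the two corners arriving;
`kirchhoffAt_zero_iff`: `E(NW) − E(SE) = i (E(NE) − E(SW))`). Scope: a Dobrushin (= marked JORDAN) domain
`D`, a family `Λ` with the three guards, a compact `K ⊆ D`; then EVENTUALLY in `δ` the relation holds at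
every lattice edge whose midpoint lies in `K`. Why true: eventually `Λ δ` is admissible and the edges at
`K` are free interior edges at distance `≥ dist(K, ∂D)/2 ≫ δ` from `zdBoundary` (whose sites lie within
`√2·δ` of `Dᶜ`), with all four incident corners medial edges of the domain; the involution
`ω ↦ ω △ {e}` pairs the passages through the four corners at `e` with the transport law
`(c, d) = e^{±iπ/6}(a, b)` (first visit identical prefixes; second visit: the loop closed in between has
total turning `±2π` because the face domain of a Jordan carrier is simply connected at every mesh —
`IsInnerFace` squares of `(Λ δ).Ω = D.carrier` cannot enclose a non-inner face), which is exactly where the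
annulus witness of stmt-11306 (marks on a hole: configuration-dependent rotation number) is excluded.
Certified exactly: kit j005379 / j006260 / j005085 / j004835 (`ℤ[ζ₂₄]`), 131 084 + 193 000 configuration
pairs incl. wired/free islands with marks on the outer boundary. Why it might fail: only through a scope
slip — a rough `∂D` producing admissible data whose `A`–`B` edges sit on an interior bubble of
`zdBoundary` (triage T5a rates it impossible for Jordan carriers: no holes); provers should state the
pathwise pairing lemma for edges all of whose four corners are medial steps of `Λ δ` and `e ∉ zdABEdges`,
`e` not a boundary-condition edge. Leans on: `MedialInterfaceProofs` (`nextCorner`, `cornerOrbit`,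
`existsUnique_medialExploration_holds`), `ExplorationWinding` (±π/2 turns), `MedialCycleHopf`
(`medialCycle_turning_holds`, the Umlaufsatz for the double-visit jump), `DartFlux`/`FKInterfacePairingProofs`
toggle cases, `bondPercolation` product structure (resampling one edge). -/
def Sig.stub_cornerKirchhoff : Prop :=
  ∀ (D : DobrushinDomain) (Λ : ℝ → DiscreteDobrushin), Guards D Λ →
    ∀ K : Set ℂ, IsCompact K → K ⊆ D.carrier →
      ∀ᶠ δ in 𝓝[>] (0:ℝ), ∀ (v : Site 2) (k : Fin 4),
        medialPoint δ s(v, v + cornerUnit k) ∈ K → KirchhoffAt (cornerField Λ δ) v k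

/-- STUB 2 — **THE STAGGERED GREEN IDENTITY** (the card's lever L1; deterministic, no probability, no
limit; provable now). For a smooth compactly supported `φ` there are `C` and `δ₀ > 0` such that for every
mesh `0 < δ < δ₀` and EVERY corner field `G : Site 2 → Fin 4 → ℂ` bounded by `M` and satisfying
`KirchhoffAt G v k` at every lattice edge `s(v, v + cornerUnit k)` whose midpoint lies in `tsupport φ`:
`‖Σ_{(v,k)} G(v,k) ∂̄φ(m_{v,k}) − i · Σ_{(v,k)} (−1)^k G(v,k) ∂φ(m_{v,k})‖ ≤ C · M`.
Proof sketch (card + three triage re-derivations + stencil tests j011066 / j011144): summation by parts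
`Σ_{(v,k)} φ(z_{v,k}) Kir_G(v,k) = 2 Σ_{(w,j)} i^j G(w,j) [φ(z_s(w,j)) − φ(z_t(w,j))]` (each edge counted
twice; reindex the four Kirchhoff terms), whose left side vanishes because `φ(z_e) ≠ 0 ⇒ z_e ∈ tsupport φ`;
Taylor to third order about `m = (z_s + z_t)/2` — the quadratic terms cancel (`z_s − m = −(z_t − m)`),
`i^j Dφ(m)[z_t − z_s] = (δ/2)[(i−1)(−1)^j ∂φ(m) − (1+i) ∂̄φ(m)]` since `z_t − z_s = δ i^j (i−1)/2`,
remainder `≤ ‖D³φ‖_∞ δ³` on the `O_φ(δ⁻²)` corners within `δ` of `tsupport φ` and `0` elsewhere; divide by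
`−(1+i)δ/2` and use `(i−1)/(1+i) = i`. (`ContDiff ℝ 3 φ` suffices; `⊤` is what the crux supplies.) Each of
the two pairings alone is `O(M δ⁻²)`. Why it might fail: only a convention slip (sign of `stag`, `∂` vs `∂̄`,
orientation of `cornerMid`) — all three cross-checked against `Negative.A0_potentialField` /
`A2_potentialField` (for a potential field `A₀ ≈ 2(1+i)δ∂H_F`, `A₂ ≈ 2(1−i)δ∂̄H_F`, and
`2(1+i) = i·2(1−i)`) and numerically (`|P₀ − iP₂| ∝ δ²·|P₀|` on smooth potentials, three seats). -/
def Sig.stub_staggeredGreenIdentity : Prop :=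
  ∀ (φ : ℂ → ℂ), ContDiff ℝ (⊤ : ℕ∞) φ → HasCompactSupport φ →
    ∃ C : ℝ, ∃ δ₀ > (0:ℝ), ∀ δ : ℝ, 0 < δ → δ < δ₀ →
      ∀ (G : Site 2 → Fin 4 → ℂ) (M : ℝ), 0 ≤ M → (∀ v k, ‖G v k‖ ≤ M) →
        (∀ (v : Site 2) (k : Fin 4), medialPoint δ s(v, v + cornerUnit k) ∈ tsupport φ →
            KirchhoffAt G v k) →
          ‖pair0 G (dbar φ) δ - Complex.I * pair2 G (del φ) δ‖ ≤ C * M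

/-- STUB 3 — **VERTEX RESUMMATION by the trace identity** (size M–L). For every family with the guards
and every test function, the crux's clause-(i) quantity and `(cos(π/12))⁻¹` times the `δ^{5/3}`-weighted
`A₀`-type corner pairing against `∂̄φ` at corner midpoints differ by `o(1)` (in fact `O(δ^{5/3})`):
`V_δ(φ) − (cos(π/12))⁻¹ δ^{5/3} Σ_{(v,k)} E_δ(v,k) ∂̄φ(m_{v,k}) → 0`.
Content: (a) the pathwise FOUR-CORNER SPLIT `2cos(π/12)·passageSum γ δ (1/3) z = Σ_{4 corners c at z}
dartPhaseSum γ δ (1/3) c` at every lattice edge `z = s(x, x + eᵢ) ∉ zdABEdges`, `δ > 0`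
(= `Sig.stub_fourCornerSplit` of `Cruxes/ParafermionPrecompact/Lines/four-class-vertex-transfer.lean`;
proved in the cdisprove-g2 evidence file, 1227 lines — re-land, do not re-derive); the four corners at
`s(x, x+e₀)` are `(x,0), (x,3), (x+e₀,1), (x+e₀,2)` (`Negative.traceH`) and every corner is incident to
exactly its source and its target edge; (b) integrability of the dart phase for admissible data
(`Sig.stub_dartPhaseIntegrable` ibid.; bounded by `1`, cylinder-measurable); (c) non-edges `z` carry
`passageSum = 0` (the exploration visits lattice edges only) and the two `A`–`B` edges have medial points
within `(√2 + ½)δ` of `Dᶜ` (their sites lie in `zdArcA ⊆ zdBoundary`), hence outside `tsupport φ ⋐ D`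
eventually — NO marks hypothesis needed (triage T4); (d) `∂̄φ(z_s) + ∂̄φ(z_t) = 2∂̄φ(m) + O(‖φ‖_{C³}δ²)` on
the `O(δ⁻²)` corners near `tsupport φ`, with `|E_δ| ≤ 1` (`norm_bondDartObservable_le_one`). Why it might
fail: only through the conventions of (a) (orientation of `cornerSource/Target`, the `take (k+1)/(k+2)`
indexing of `windingAt`), each triage-verified for the sibling line and certified exactly on small boxes
(`S1 ≤ 2.5e-16`, compute-summary §1). -/
def Sig.stub_vertexResummation : Prop :=
  ∀ (D : DobrushinDomain) (Λ : ℝ → DiscreteDobrushin), Guards D Λ → ∀ φ : ℂ → ℂ, TestFn D φ →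
    Tendsto (fun δ : ℝ => vertexPairing Λ φ δ
        - (((Real.cos (Real.pi / 12))⁻¹ : ℝ) : ℂ) * ((((δ ^ ((5:ℝ) / 3) : ℝ)) : ℂ) * pair0 (cornerField Λ δ) (dbar φ) δ))
      (𝓝[>] (0:ℝ)) (𝓝 0)

/-- STUB 4 — **QUARTER-TURN COVARIANCE OF COHERENCE** (lever L2a; size L, exact bookkeeping; the input
`Negative.CharacterSelectionLoadBearing` proves NECESSARY). If `u` is a universal coherence vector then so
is `u ∘ classShift`. Content: the EXACT covariance `E^{RD,RΛ}_δ(Rv, Rf − e₀) = E^{D,Λ}_δ(v, f)`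
(`R` the counter-clockwise quarter turn; certified by exact enumeration, 40 corners, deviation `0.0`):
`P_{1/2}` is invariant under the graph automorphism `R` (`bondPercolation_map_relabel_iso` with
`zdSignedPermIso`), every ingredient of `IsMedialExploration` (`meshDomain`, `IsInnerFace`, `zdBoundary`,
`zdDiscreteArc` via `Metric.infDist`, `bcBondConfig`, `IsMedialTurn`, the start corner) is equivariant
under the isometry `z ↦ iz`, so `medialExploration (RΛ δ) (ω ∘ R⁻¹) = R̃ (medialExploration (Λ δ) ω)` by
uniqueness (`existsUnique_medialExploration_holds`; junk `[] ↦ []`, no admissibility needed), medial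
points rotate and the total-turning winding is rotation INVARIANT (`winding_map_affine`, `κ = I`); the
rotated datum `RΛ δ = ⟨I • Ω, δ, I • arcA, I • arcB⟩` is a family of the ROTATED Dobrushin domain `RD`
(definition request D1 `MarkedDomain.mulI`: all `JordanDomain`/`MarkedDomain` fields transport along
`z ↦ iz`; routine, not in `PlanarDomains.lean`). Applying `EdgeCoherenceWith u` to `(R⁻¹D, R⁻¹Λ, R⁻¹K)`
gives coherence of `E^{D,Λ}` with `u ∘ classShift⁻¹`; three applications (or the clockwise turn) give
`u ∘ classShift` (`classShift⁴ = id` on `ℤ²`). Why it might fail: it cannot mathematically (an exact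
symmetry of every definition involved); the risk is bookkeeping volume (six small equivariance lemmas +
D1) and a hidden coordinate convention in `IsMedialExploration`'s start-corner clause (audited: none —
triage T5b). -/
def Sig.stub_quarterTurnCoherence : Prop :=
  ∀ u : Site 2 → ℂ, EdgeCoherenceWith u → EdgeCoherenceWith (fun o => u (classShift o))

/-- STUB 5 — **CHARACTER OR NULL ⇒ ONE MODE PAIRING IS NULL** (lever L2b; finitary, size M). Let `u` be
non-zero on some class and let BOTH `u` and `u ∘ classShift` be coherence vectors (S4). Then either every
`δ^{5/3}`-weighted plain corner pairing of the percolation corner field is null, or every STAGGERED one is: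
for all families with the guards and all test functions `ψ`,
`δ^{5/3} Σ_{(v,k)} E_δ(v,k) ψ(m_{v,k}) → 0` (first alternative) resp.
`δ^{5/3} Σ_{(v,k)} (−1)^k E_δ(v,k) ψ(m_{v,k}) → 0` (second). Proof plan: (1) DICHOTOMY on the sixteen
numbers `u(o), u(classShift o)`: if `u ∦ u ∘ classShift` on the four class offsets, the 2×2 elimination
`E_p (u_{o′}w_o − u_o w_{o′}) = w_p(u_{o′}E_o − u_oE_{o′}) + u_{o′}(w_oE_p − w_pE_o) − u_o(w_{o′}E_p − w_pE_{o′})`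
(`w = u ∘ classShift`, a pair `o, o′` with non-zero minor) bounds EVERY corner value by `C(u)·ε·δ^{1/3}`
on compacts, eventually, for every family (NULL: both alternatives hold); else `u ∘ classShift = λu` on
the classes, `λ⁴ = 1` (`classShift` cycles the four offsets `0 ↦ −e₀ ↦ −e₀−e₁ ↦ −e₁ ↦ 0`), `u` vanishes
on no class, and `k ↦ u(−cornerOff k)` is a `Negative.IsZ4Character`; (2) λ-TABLE: `λ ≠ 1 ⇒ Σ_k u_k = 0 ⇒
|u₀|·|Σ_k E(v,k)| = |Σ_k (u₀E_k − u_kE₀)| ≤ 4εδ^{1/3}` (first alternative; `Negative.character_const_of_A0_ne_zero`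
contrapositive = TraceKillsCharacters), `λ = 1 ⇒ u` constant `⇒ |u₀|·|Σ_k (−1)^k E(v,k)| ≤ 4εδ^{1/3}`
(second alternative); (3) COUNTING: for `ψ ∈ C_c^∞(D)` take `K = cthickening ρ (tsupport ψ) ⊆ D`; the
corners with `m_{v,k} ∈ tsupport ψ` number `≤ C_ψ δ⁻²` and have `δv ∈ K` once `δ < ρ`; move `ψ(m_{v,k})`
to `ψ(δv)` at cost `‖∇ψ‖_∞ δ` per corner using `|E_δ| ≤ 1` (`O(δ^{2/3})` after the weight); total
`≤ C_ψ·ε/|u₀| + o(1)`. Honours Disproof §E: without S4's second coherence vector the non-character coherent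
Kirchhoff model `modelField μ` (`uModel_not_character`, `A0_modelField`, `A2_modelField`: neither mode
small) would defeat the conclusion — here `uModel μ ∘ classShift` is NOT a coherence vector of that model
unless `μ = ±1`. Why it might fail: it cannot once S4 is available (pure algebra + counting); the only
delicate point is the null branch's uniformity (the minor is a property of `u` alone, so `C(u)` is
universal and two eventually-in-`δ` sets intersect). -/
def Sig.stub_characterOrNull : Prop :=
  ∀ u : Site 2 → ℂ, (∃ o : Site 2, IsCorner 0 o ∧ u o ≠ 0) →
    EdgeCoherenceWith u → EdgeCoherenceWith (fun o => u (classShift o)) →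
      (∀ (D : DobrushinDomain) (Λ : ℝ → DiscreteDobrushin), Guards D Λ → ∀ ψ : ℂ → ℂ, TestFn D ψ →
          Tendsto (fun δ : ℝ => (((δ ^ ((5:ℝ) / 3) : ℝ)) : ℂ) * pair0 (cornerField Λ δ) ψ δ)
            (𝓝[>] (0:ℝ)) (𝓝 0)) ∨
      (∀ (D : DobrushinDomain) (Λ : ℝ → DiscreteDobrushin), Guards D Λ → ∀ ψ : ℂ → ℂ, TestFn D ψ →
          Tendsto (fun δ : ℝ => (((δ ^ ((5:ℝ) / 3) : ℝ)) : ℂ) * pair2 (cornerField Λ δ) ψ δ)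
            (𝓝[>] (0:ℝ)) (𝓝 0))

/-- STUB 6 — **PRECOMPACTNESS TRANSFER, corners → vertices** (clause (ii); size M; coherence-free).
`EdgePrecompact → PrecompactFamilies`: by the four-corner split (S3 (a)–(b)) `2cos(π/12) F_δ(z) = Σ` of
the four corner observables at `z` for every lattice edge `z ∉ zdABEdges`; the four corners at a
horizontal and at a vertical edge carry the same four classes (`Negative.traceH` / `traceV`; the sibling's
`partner` / `class_partner`), so the equicontinuity clause only ever compares SAME-CLASS corners at sites
within `δ/2` of the two medial points — invoke `EdgePrecompact` (both clauses; (ii) is load-bearing by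
`Negative.traceH_stag_jump`) on the `ρ`-thickening `cthickening ρ K ⊆ D`
(`IsCompact.exists_cthickening_subset_open`), `η = η′/2`, meshes `δ < min ρ (η′/2)`; clause (i) is the
triangle inequality with constant `4C/(2cos(π/12))`; the two `A`–`B` edges are disposed of WITHOUT marks
as in S3 (c). This is `parafermionPrecompactRepairedAt_of` of
`Cruxes/ParafermionPrecompact/Lines/four-class-vertex-transfer.lean` for the 3-field families of this crux
(that file's six-field `hmarks` replaced by the `zdBoundary` distance bound) — reuse its `cornersAt`,
`dist_fst_cornersAt_medialPoint`, `splitConst_mul_F_eq`. Why it might fail: it cannot given S3 (a)–(b);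
`blocked-on` nothing (EdgePrecompact is the HYPOTHESIS here, not a stub). -/
def Sig.stub_precompactTransfer : Prop :=
  EdgePrecompact → PrecompactFamilies

/-- Registered stub 1 (Kirchhoff, `χ = +i`, Jordan scope). -/
theorem stub_cornerKirchhoff : Sig.stub_cornerKirchhoff := by
  sorry

/-- Registered stub 2 (the staggered Green identity — the lever). -/
theorem stub_staggeredGreenIdentity : Sig.stub_staggeredGreenIdentity := by
  sorry

/-- Registered stub 3 (vertex resummation by the trace identity). -/
theorem stub_vertexResummation : Sig.stub_vertexResummation := by
  sorry

/-- Registered stub 4 (quarter-turn covariance of coherence). -/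
theorem stub_quarterTurnCoherence : Sig.stub_quarterTurnCoherence := by
  sorry

/-- Registered stub 5 (character or null ⇒ a mode pairing is null). -/
theorem stub_characterOrNull : Sig.stub_characterOrNull := by
  sorry

/-- Registered stub 6 (precompactness transfer). -/
theorem stub_precompactTransfer : Sig.stub_precompactTransfer := by
  sorry

/-! ### Glue lemmas (elementary, proved) -/

/-- The crux integrand is the named dart phase sum of `DartPhase.lean`. -/
theorem cornerPhase_eq_dartPhaseSum (E : DiscreteDobrushin) (δ : ℝ) (v f : Site 2)
    (ω : BondConfig (Site 2)) :
    cornerPhase E δ v f ω = Parafermion.dartPhaseSum (medialExploration E ω) δ (1 / 3) (v, f) := by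
  unfold cornerPhase Parafermion.dartPhaseSum
  refine Finset.sum_congr rfl fun k _ => ?_
  congr 1
  push_cast
  ring

/-- The corner observable is the percolation dart observable `bondDartObservable (Λ δ) δ (1/3) (v, f)`. -/
theorem cornerObs_eq_bondDartObservable (Λ : ℝ → DiscreteDobrushin) (δ : ℝ) (v f : Site 2) :
    cornerObs Λ δ v f = Parafermion.bondDartObservable (Λ δ) δ (1 / 3) (v, f) := by
  simp only [cornerObs, cornerPhase_eq_dartPhaseSum, Parafermion.bondDartObservable_def]

/-- `|E_δ(c)| ≤ 1` (at most one unimodular passage of each corner, probability measure). -/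
theorem norm_cornerField_le_one (Λ : ℝ → DiscreteDobrushin) (δ : ℝ) (v : Site 2) (k : Fin 4) :
    ‖cornerField Λ δ v k‖ ≤ 1 := by
  unfold cornerField
  rw [cornerObs_eq_bondDartObservable]
  exact Parafermion.norm_bondDartObservable_le_one _ _ _ _

/-- The linear read-out `L ↦ (L 1 + i L i)/2` of a real-linear map (so that `∂̄ψ = dbarCLM ∘ Dψ`). -/
def dbarRead (L : ℂ →L[ℝ] ℂ) : ℂ := (L 1 + Complex.I * L Complex.I) / 2

/-- The linear read-out `L ↦ (L 1 − i L i)/2` (so that `∂ψ = delRead ∘ Dψ`). -/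
def delRead (L : ℂ →L[ℝ] ℂ) : ℂ := (L 1 - Complex.I * L Complex.I) / 2

theorem dbar_eq_comp (ψ : ℂ → ℂ) : dbar ψ = dbarRead ∘ fderiv ℝ ψ := rfl

theorem del_eq_comp (ψ : ℂ → ℂ) : del ψ = delRead ∘ fderiv ℝ ψ := rfl

@[simp] theorem dbarRead_zero : dbarRead 0 = 0 := by simp [dbarRead]

@[simp] theorem delRead_zero : delRead 0 = 0 := by simp [delRead]

/-- `∂̄` of a test function is a test function (smooth; support inside that of `φ`). -/
theorem testFn_dbar {D : DobrushinDomain} {φ : ℂ → ℂ} (h : TestFn D φ) : TestFn D (dbar φ) := by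
  obtain ⟨hφ, hsupp, hsub⟩ := h
  have hF : ContDiff ℝ (⊤ : ℕ∞) (fderiv ℝ φ) := (contDiff_infty_iff_fderiv.1 hφ).2
  refine ⟨?_, ?_, ?_⟩
  · have h1 : ContDiff ℝ (⊤ : ℕ∞) (fun p => fderiv ℝ φ p 1) := hF.clm_apply contDiff_const
    have h2 : ContDiff ℝ (⊤ : ℕ∞) (fun p => fderiv ℝ φ p Complex.I) := hF.clm_apply contDiff_const
    exact (h1.add (contDiff_const.mul h2)).div_const 2
  · rw [dbar_eq_comp]
    exact (hsupp.fderiv ℝ).comp_left dbarRead_zero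
  · rw [dbar_eq_comp]
    exact ((tsupport_comp_subset dbarRead_zero _).trans (tsupport_fderiv_subset ℝ)).trans hsub

/-- `∂` of a test function is a test function. -/
theorem testFn_del {D : DobrushinDomain} {φ : ℂ → ℂ} (h : TestFn D φ) : TestFn D (del φ) := by
  obtain ⟨hφ, hsupp, hsub⟩ := h
  have hF : ContDiff ℝ (⊤ : ℕ∞) (fderiv ℝ φ) := (contDiff_infty_iff_fderiv.1 hφ).2
  refine ⟨?_, ?_, ?_⟩
  · have h1 : ContDiff ℝ (⊤ : ℕ∞) (fun p => fderiv ℝ φ p 1) := hF.clm_apply contDiff_const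
    have h2 : ContDiff ℝ (⊤ : ℕ∞) (fun p => fderiv ℝ φ p Complex.I) := hF.clm_apply contDiff_const
    exact (h1.sub (contDiff_const.mul h2)).div_const 2
  · rw [del_eq_comp]
    exact (hsupp.fderiv ℝ).comp_left delRead_zero
  · rw [del_eq_comp]
    exact ((tsupport_comp_subset delRead_zero _).trans (tsupport_fderiv_subset ℝ)).trans hsub

/-- `δ^{5/3} → 0` along `δ → 0⁺`. -/
theorem tendsto_rpow_five_thirds :
    Tendsto (fun δ : ℝ => δ ^ ((5:ℝ) / 3)) (𝓝[>] (0:ℝ)) (𝓝 0) := by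
  have hc : ContinuousAt (fun δ : ℝ => δ ^ ((5:ℝ) / 3)) 0 :=
    Real.continuousAt_rpow_const 0 _ (Or.inr (by norm_num))
  have h := hc.tendsto
  rw [Real.zero_rpow (by norm_num)] at h
  exact h.mono_left nhdsWithin_le_nhds

/-- Squeeze: an eventually bounded quantity times the weight `δ^{5/3}` tends to `0`. -/
theorem tendsto_weight_mul_of_eventually_le {f : ℝ → ℂ} {C : ℝ}
    (h : ∀ᶠ δ in 𝓝[>] (0:ℝ), ‖f δ‖ ≤ C) :
    Tendsto (fun δ : ℝ => (((δ ^ ((5:ℝ) / 3) : ℝ)) : ℂ) * f δ) (𝓝[>] (0:ℝ)) (𝓝 0) := by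
  have hb : Tendsto (fun δ : ℝ => δ ^ ((5:ℝ) / 3) * |C|) (𝓝[>] (0:ℝ)) (𝓝 0) := by
    simpa using tendsto_rpow_five_thirds.mul_const |C|
  refine squeeze_zero_norm' ?_ hb
  filter_upwards [h, self_mem_nhdsWithin] with δ hδ hpos
  rw [norm_mul, Complex.norm_real, Real.norm_eq_abs,
    abs_of_nonneg (Real.rpow_nonneg (le_of_lt hpos) _)]
  exact mul_le_mul_of_nonneg_left (hδ.trans (le_abs_self C)) (Real.rpow_nonneg (le_of_lt hpos) _)

/-! ### The composition: the six stubs give the crux BY NAME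

The card's TRANSFER `C⁺` (the two halves DECOUPLE: `EdgePrecompact` is not used for clause (i),
`EdgeCoherence` not for clause (ii)) is proved on the way, not stubbed: `coherentMoreraPlus_of`. -/

/-- The card's transfer target `C⁺ := (EdgeCoherence → WeakHolomorphyFamilies) ∧ (EdgePrecompact →
PrecompactFamilies)` — strictly stronger than the crux (`coherentMorera_of_plus`). -/
def CoherentMoreraPlus : Prop :=
  (EdgeCoherence → WeakHolomorphyFamilies) ∧ (EdgePrecompact → PrecompactFamilies)

/-- `C⁺ ⇒` the crux (pure logic; the two conclusion clauses are the crux's verbatim). Stated with the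
crux UNFOLDED (`coherentMorera_iff`) so that the only theorems of this file concluding the audit target
`CoherentMorera` by name are the skeleton `CoherentMorera_of` / `CoherentMorera_proof`. -/
theorem coherentMorera_of_plus (h : CoherentMoreraPlus) :
    EdgeCoherence → EdgePrecompact → (WeakHolomorphyFamilies ∧ PrecompactFamilies) :=
  fun hc hp => ⟨h.1 hc, h.2 hp⟩

/-- **Clause (i) from coherence alone.** Write `EdgeCoherence = ∃ u, … ∧ EdgeCoherenceWith u`; S4 makes
`u ∘ classShift` a coherence vector too; S5 gives the alternative. FIRST alternative: the plain corner
pairing against `∂̄φ` is null, and S3 turns it into the clause. SECOND alternative: the staggered pairing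
against `∂φ` is null; S1 gives Kirchhoff at the edges with midpoint in `tsupport φ` eventually, so S2 (with
`M = 1`, `|E_δ| ≤ 1`) bounds `‖P₀ − iP₂‖ ≤ C` eventually and the weight `δ^{5/3}` kills it; hence
`δ^{5/3}P₀ = δ^{5/3}(P₀ − iP₂) + i·δ^{5/3}P₂ → 0`, and S3 again. `EdgePrecompact` is not used. -/
theorem weakHolomorphyFamilies_of :
    Sig.stub_cornerKirchhoff → Sig.stub_staggeredGreenIdentity → Sig.stub_vertexResummation →
      Sig.stub_quarterTurnCoherence → Sig.stub_characterOrNull → EdgeCoherence →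
        WeakHolomorphyFamilies := by
  intro hKir hGreen hRes hRot hChar hC D Λ hΩ hδ hadm φ hφ hsupp hsub
  obtain ⟨u, hu0, hcoh⟩ := hC
  have hcoh' : EdgeCoherenceWith (fun o => u (classShift o)) := hRot u hcoh
  have hG : Guards D Λ := ⟨hΩ, hδ, hadm⟩
  have hT : TestFn D φ := ⟨hφ, hsupp, hsub⟩
  -- the weighted plain corner pairing against ∂̄φ is null, in both alternatives
  have key : Tendsto (fun δ : ℝ => (((δ ^ ((5:ℝ) / 3) : ℝ)) : ℂ) * pair0 (cornerField Λ δ) (dbar φ) δ)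
      (𝓝[>] (0:ℝ)) (𝓝 0) := by
    rcases hChar u hu0 hcoh hcoh' with hA | hB
    · exact hA D Λ hG (dbar φ) (testFn_dbar hT)
    · have h2 : Tendsto (fun δ : ℝ => (((δ ^ ((5:ℝ) / 3) : ℝ)) : ℂ) * pair2 (cornerField Λ δ) (del φ) δ)
          (𝓝[>] (0:ℝ)) (𝓝 0) := hB D Λ hG (del φ) (testFn_del hT)
      obtain ⟨C, δ₀, hδ₀, hCδ⟩ := hGreen φ hφ hsupp
      have hK : ∀ᶠ δ in 𝓝[>] (0:ℝ), ∀ (v : Site 2) (k : Fin 4),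
          medialPoint δ s(v, v + cornerUnit k) ∈ tsupport φ → KirchhoffAt (cornerField Λ δ) v k :=
        hKir D Λ hG (tsupport φ) hsupp hsub
      have hlt : ∀ᶠ δ in 𝓝[>] (0:ℝ), δ < δ₀ :=
        (eventually_lt_nhds hδ₀).filter_mono nhdsWithin_le_nhds
      have hev : ∀ᶠ δ in 𝓝[>] (0:ℝ),
          ‖pair0 (cornerField Λ δ) (dbar φ) δ - Complex.I * pair2 (cornerField Λ δ) (del φ) δ‖ ≤ C * 1 := by
        filter_upwards [hK, hlt, self_mem_nhdsWithin] with δ hKδ hltδ hpos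
        exact hCδ δ hpos hltδ (cornerField Λ δ) 1 zero_le_one (norm_cornerField_le_one Λ δ) hKδ
      have hdiff := tendsto_weight_mul_of_eventually_le hev
      have hsum := hdiff.add (h2.const_mul Complex.I)
      rw [mul_zero, add_zero] at hsum
      refine hsum.congr' (Eventually.of_forall fun δ => ?_)
      ring
  have h3 := hRes D Λ hG φ hT
  have h4 := h3.add (key.const_mul ((((Real.cos (Real.pi / 12))⁻¹ : ℝ)) : ℂ))
  rw [mul_zero, add_zero] at h4
  have h5 : Tendsto (fun δ : ℝ => vertexPairing Λ φ δ) (𝓝[>] (0:ℝ)) (𝓝 0) := by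
    refine h4.congr' (Eventually.of_forall fun δ => ?_)
    ring
  exact h5

/-- **The transfer target `C⁺` from the six stubs** (S6 is its second half verbatim). -/
theorem coherentMoreraPlus_of :
    Sig.stub_cornerKirchhoff → Sig.stub_staggeredGreenIdentity → Sig.stub_vertexResummation →
      Sig.stub_quarterTurnCoherence → Sig.stub_characterOrNull → Sig.stub_precompactTransfer →
        CoherentMoreraPlus :=
  fun h₁ h₂ h₃ h₄ h₅ h₆ => ⟨weakHolomorphyFamilies_of h₁ h₂ h₃ h₄ h₅, h₆⟩

/-- **The line.** Kirchhoff + the staggered Green identity + vertex resummation + quarter-turn covariance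
+ character-or-null + precompactness transfer imply `CoherentMorera` (BY NAME), through `C⁺`. -/
theorem CoherentMorera_of :
    Sig.stub_cornerKirchhoff → Sig.stub_staggeredGreenIdentity → Sig.stub_vertexResummation →
      Sig.stub_quarterTurnCoherence → Sig.stub_characterOrNull → Sig.stub_precompactTransfer →
        CoherentMorera :=
  fun h₁ h₂ h₃ h₄ h₅ h₆ => coherentMorera_of_plus (coherentMoreraPlus_of h₁ h₂ h₃ h₄ h₅ h₆)

/-- The skeleton in its final shape: the crux BY NAME from the six registered stubs (depends on
`sorryAx` only through them). -/
theorem CoherentMorera_proof : CoherentMorera :=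
  CoherentMorera_of stub_cornerKirchhoff stub_staggeredGreenIdentity stub_vertexResummation
    stub_quarterTurnCoherence stub_characterOrNull stub_precompactTransfer

/-! ### Checked remarks (not obligations) -/

/-- `classShift` cycles the four class offsets `0 ↦ −e₀ ↦ −e₀−e₁ ↦ −e₁ ↦ 0`, i.e. `−cornerOff k ↦
−cornerOff (k+1)`. -/
theorem classShift_neg_cornerOff (k : Fin 4) : classShift (-cornerOff k) = -cornerOff (k + 1) := by
  fin_cases k <;> decide

/-- `classShift` has order four on all of `ℤ²` (so S4 iterated thrice gives the inverse shift). -/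
theorem classShift_classShift_classShift_classShift (o : Site 2) :
    classShift (classShift (classShift (classShift o))) = o := by
  ext i
  fin_cases i <;> simp [classShift]

/-- The λ-table behind S5, for the record: a `ℤ₄`-character has trace zero unless `λ = 1` … -/
theorem character_trace_eq_zero {u : Fin 4 → ℂ} {l : ℂ} (hl : l ^ 4 = 1) (hl1 : l ≠ 1)
    (hu : ∀ k, u (k + 1) = l * u k) : u 0 + u 1 + u 2 + u 3 = 0 := by
  have h1 : u 1 = l * u 0 := hu 0
  have h2 : u 2 = l * u 1 := hu 1
  have h3 : u 3 = l * u 2 := hu 2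
  have hfac : (l - 1) * (u 0 + u 1 + u 2 + u 3) = 0 := by
    rw [h3, h2, h1]; linear_combination u 0 * hl
  rcases mul_eq_zero.1 hfac with h | h
  · exact absurd (sub_eq_zero.1 h) hl1
  · exact h

/-- … and staggered sum zero unless `λ = −1` (so for `λ = 1`, the conformal character, the staggered mode
is the one coherence kills). -/
theorem character_stagger_eq_zero {u : Fin 4 → ℂ} {l : ℂ} (hl : l ^ 4 = 1) (hl1 : l ≠ -1)
    (hu : ∀ k, u (k + 1) = l * u k) : u 0 - u 1 + u 2 - u 3 = 0 := by
  have h1 : u 1 = l * u 0 := hu 0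
  have h2 : u 2 = l * u 1 := hu 1
  have h3 : u 3 = l * u 2 := hu 2
  have hfac : (l + 1) * (u 0 - u 1 + u 2 - u 3) = 0 := by
    rw [h3, h2, h1]; linear_combination (-(u 0)) * hl
  rcases mul_eq_zero.1 hfac with h | h
  · exact absurd (eq_neg_of_add_eq_zero_left h) hl1
  · exact h

/-- Disproof §E in this file's language: the tightness model's vector `uModel μ` is `classShift`-parallel
(a character) only for `μ = ±1` — so S4's output is exactly what excludes `modelField μ`. -/
theorem uModel_parallel_only_if {μ : ℂ}
    (h : IsZ4Character (Summit.CriticalPhenomena.CardyFormulaZ2.Theorems.CoherentMorera.Negative.uModel μ)) :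
    μ = 1 ∨ μ = -1 :=
  Summit.CriticalPhenomena.CardyFormulaZ2.Theorems.CoherentMorera.Negative.uModel_not_character h

end Summit.CriticalPhenomena.CardyFormulaZ2.Cruxes.CoherentMorera.StaggeredGreenTransfer

end
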